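import Mathlib
import HarnessLib
import Literature.Probability.LatticeModels.TorusFourierWeightedConvolution
import Summits.HubbardSuperconductivity.HubbardSuperconductivity.Theorems.KLProgrammeKLRegimeEngineFrameShiftResponse

/-!
# K3 gen-8-FLOW (stmt 20437 `KLRegimeEngineV17F2`, stub (C), door (B) = S6 door (2)): the covariance / frame-shift response of the
# two-leg kernel in MOMENT form — weighted Fourier-`ℓ¹` over the spatial leg momentum, by Polchinski interpolation

Cell gate-hubbard-kl, seat p2 g11.  Door (1) (p515302 `covResp_norm_kernel_two_sub_le`, p525713 `covResp_norm_selfEnergy_frameShift_sub_le`) bounds the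
VALUE of the response `𝒲[s₁]₂(X_q) − 𝒲[s₀]₂(X_q)` at one reading string.  The (B) half of stub (C) (c4a-1's split, KL STATUS 2026-08-27 l.2755) needs
the response in JET form: the `θ`-jets of the interpolated reading are controlled by the position-space MOMENTS
`Σ_x w(x)·|𝔉⁻¹[k⃗ ↦ data(k⃗)](x)|` of the momentum data (`…SplitSymInterpPureMoments`), so the door must bound the moments of
`k⃗ ↦ 𝒲[s₁]₂(X_{((ω_i,k⃗),σ)}) − 𝒲[s₀]₂(X_{((ω_i,k⃗),σ)})`.  Same mechanism as door (1) — Salmhofer's RGE along `C_t = C₀ + t(C₁ − C₀)` read through a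
LINEAR FUNCTIONAL (`Literature/…/GrassmannCovarianceResponseTwoLeg.norm_apply_effAction_sub_le_of_linePath`) — with the functional
`Φ_u(F) = Σ_x w(x)·u_x·𝔉⁻¹[k⃗ ↦ kernel F 2 X_{(ω_i,k⃗,σ)}](x)` whose PHASES `u_x` (`‖u_x‖ ≤ 1`) are read off the endpoint difference, so that
`Φ_u(𝒲[s₁]) − Φ_u(𝒲[s₀])` IS the weighted moment; the loop term is a LINEAR COMBINATION over `A` of four-leg data (moments add:
`sum_mul_norm_torusFourierInv_sum_le_of_le`), the tree term `4ṡ(q)𝒲₂(X_q)²` is a PRODUCT (moments multiply for a submultiplicative weight: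
`sum_mul_norm_torusFourierInv_mul_sq_le`, `Literature/…/TorusFourierWeightedConvolution`):

* `covResp_moment_kernel_two_laplacian_le` — loop term: `M_w[kernel (Δ_Ċ 𝒲) 2 X_{(ω_i,·,σ)}] ≤ 12·(Σ_p‖ṡ p‖)·N_w`, `N_w` a bound on the moments of the
  four-leg data `k⃗ ↦ 𝒲₄(X_{(ω_i,k⃗,σ)}, Ā, A)` uniformly in `A`;
* **`covResp_moment_kernel_two_sub_le`** — `M_w[𝒲[s₁]₂ − 𝒲[s₀]₂] ≤ 12·(Σ_p‖(s₁−s₀) p‖)·N_w + 2·D_w·S_w²` for a non-negative submultiplicative weight `w`,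
  with `S_w` the moments of the two-leg data and `D_w` the moments of the symbol difference `k⃗ ↦ (s₁−s₀)((ω_i,k⃗),σ)` at the reading frequency;
* `selfEnergy_moment_sub_le` — the same ×`2|β|L²` for `selfEnergy`;
* **`moment_selfEnergy_frameShift_sub_le`** — at `s_j = uvSymbolCT … K_j Λ`: the loop part composed with door (1)'s `sum_norm_uvSymbolCT_sub_le`
  (`Σ_p‖Ψ_{K₁} − Ψ_{K₀}‖ ≤ 2L²(2B₁+1)βL²(2β/Λ)·frameDist K₁ K₀`), the tree part left conditional on the symbol-difference moments `D_w` (the (S)-half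
  supplier: sampled mixed differences of `Ψ(ω, e_{K₁}) − Ψ(ω, e_{K₀})` with one frame-difference jet per term, `HubbardUVSymbolFibreSampling`);
* `sum_mul_abs_torusCosCoeff_re_le` — the bridge to the READING currency: for an even weight the `torusCosCoeff` moments of the real part of complex data
  are bounded by the moments of its inverse transform (`Literature/…/TorusFourierWeightedConvolution.sum_mul_abs_cosCoeff_re_le`).

Proofs only; `N_w`, `S_w`, `D_w`, `B₁` are hypotheses; nothing about their sizes is asserted; nothing asserts superconductivity.
References: Salmhofer 1998 §3.1 Prop. 1, §4.1 [cite: Salmhofer1998]; BGM 2006 §2.1 (2.36aa), §3 (3.3) [cite: BenfattoGiulianiMastropietro2006].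
-/

noncomputable section

namespace Summit.HubbardSuperconductivity.HubbardSuperconductivity.Theorems.EngineV8

set_option linter.dupNamespace false -- summit = problem name (single-conjunct summit), D-0017

open Finset Literature.MathematicalPhysics.QuantumLattice Literature.Probability.LatticeModels GrassmannAlgebra
open Summit.HubbardSuperconductivity.HubbardSuperconductivity.Theorems.KLRegimeSplit
open scoped ComplexConjugate

variable {L M : ℕ} [NeZero L]

/-! ## §1 Phases and the weighted functional -/

omit [NeZero L] in
/-- The phase `u = conj z/‖z‖` has norm `≤ 1`. -/
theorem norm_conj_div_norm_le_one (z : ℂ) : ‖conj z / (‖z‖ : ℂ)‖ ≤ 1 := by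
  rcases eq_or_ne z 0 with rfl | hz
  · simp
  · rw [norm_div, Complex.norm_conj, Complex.norm_real, Real.norm_of_nonneg (norm_nonneg _), div_self (norm_ne_zero_iff.2 hz)]

omit [NeZero L] in
/-- The phase recovers the norm: `(conj z/‖z‖)·z = ‖z‖`. -/
theorem conj_div_norm_mul_self (z : ℂ) : conj z / (‖z‖ : ℂ) * z = (‖z‖ : ℂ) := by
  rcases eq_or_ne z 0 with rfl | hz
  · simp
  · have hn : (‖z‖ : ℂ) ≠ 0 := by exact_mod_cast norm_ne_zero_iff.2 hz
    rw [div_mul_eq_mul_div, div_eq_iff hn, Complex.conj_mul']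
    ring

/-- **A phase-weighted sum of inverse transforms is bounded by the weighted moment**: for `w ≥ 0` and `‖u_x‖ ≤ 1`,
`‖Σ_x w(x)·u_x·f̌(x)‖ ≤ Σ_x w(x)‖f̌(x)‖`. -/
theorem norm_sum_weight_phase_mul_le {w : TorusSite 2 L → ℝ} (hw0 : ∀ x, 0 ≤ w x) {u : TorusSite 2 L → ℂ} (hu : ∀ x, ‖u x‖ ≤ 1)
    (g : TorusSite 2 L → ℂ) : ‖∑ x, (w x : ℂ) * u x * g x‖ ≤ ∑ x, w x * ‖g x‖ := by
  refine (norm_sum_le _ _).trans (sum_le_sum fun x _ => ?_)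
  rw [norm_mul, norm_mul, Complex.norm_real, Real.norm_of_nonneg (hw0 x)]
  calc w x * ‖u x‖ * ‖g x‖ ≤ w x * 1 * ‖g x‖ := mul_le_mul_of_nonneg_right (mul_le_mul_of_nonneg_left (hu x) (hw0 x)) (norm_nonneg _)
    _ = w x * ‖g x‖ := by rw [mul_one]

/-! ## §2 The loop term in moment form -/

omit [NeZero L] in
/-- `‖((3·4/2 : ℚ) • 1 : ℂ)‖ = 6` (the pair-position count of `kernel_grassmannLaplacian` at degree `2`). -/
private theorem norm_pairPositions_two' : ‖(((((2 + 1) * (2 + 2) : ℕ) : ℚ) / 2) • (1 : ℂ))‖ = 6 := by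
  rw [show ((((2 + 1) * (2 + 2) : ℕ) : ℚ) / 2) = (6 : ℚ) by norm_num, Rat.smul_one_eq_cast, Rat.cast_ofNat]
  exact RCLike.norm_ofNat 6

/-- **The loop term of the response in MOMENT form**: for `Ċ = normalCovariance ṡ` and a weight `w ≥ 0`, if the moments of the four-leg data
`k⃗ ↦ 𝒲₄(X_{(ω_i,k⃗,σ)}, Ā, A)` are `≤ N` for every `A`, then `Σ_x w(x)‖𝔉⁻¹[k⃗ ↦ kernel (Δ_Ċ 𝒲) 2 X_{(ω_i,k⃗,σ)}](x)‖ ≤ 12·(Σ_p‖ṡ p‖)·N`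
(the loop term is the linear combination `6·Σ_A Ċ(A,Ā)·𝒲₄(X, Ā, A)`; entry sum `Σ_A‖Ċ(A,Ā)‖ = 2Σ_p‖ṡ p‖`). -/
theorem covResp_moment_kernel_two_laplacian_le (sdot : FreqMomentum L M × Fin 2 → ℂ) (W : HubbardGrassmann L M) (i : MatsubaraIdx M)
    (σ : Fin 2) {w : TorusSite 2 L → ℝ} (hw0 : ∀ x, 0 ≤ w x) {N : ℝ}
    (hN : ∀ A : HubbardFieldIdx L M, ∑ x, w x * ‖torusFourierInv (fun kv : TorusSite 2 L =>
      kernel ℂ W 4 (Fin.snoc (Fin.snoc ![((((i, kv), σ), 0) : HubbardFieldIdx L M), (((i, kv), σ), 1)] (A.1, 1 - A.2) :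
        Fin 3 → HubbardFieldIdx L M) A)) x‖ ≤ N) :
    ∑ x, w x * ‖torusFourierInv (fun kv : TorusSite 2 L =>
        kernel ℂ (grassmannLaplacian ℂ (normalCovariance L M sdot) W) 2 ![((((i, kv), σ), 0) : HubbardFieldIdx L M), (((i, kv), σ), 1)]) x‖ ≤
      12 * (∑ p, ‖sdot p‖) * N := by
  classical
  -- the loop kernel as `c₆ · Σ_A Ċ(A,Ā) · 𝒲₄(X, Ā, A)`
  set c₆ : ℂ := ((((2 + 1) * (2 + 2) : ℕ) : ℚ) / 2) • (1 : ℂ) with hc₆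
  have hker : ∀ kv : TorusSite 2 L,
      kernel ℂ (grassmannLaplacian ℂ (normalCovariance L M sdot) W) 2 ![((((i, kv), σ), 0) : HubbardFieldIdx L M), (((i, kv), σ), 1)] =
        c₆ * ∑ A : HubbardFieldIdx L M, normalCovariance L M sdot A (A.1, 1 - A.2) *
          kernel ℂ W 4 (Fin.snoc (Fin.snoc ![((((i, kv), σ), 0) : HubbardFieldIdx L M), (((i, kv), σ), 1)] (A.1, 1 - A.2) :
            Fin 3 → HubbardFieldIdx L M) A) := by
    intro kv
    rw [kernel_grassmannLaplacian, ← hc₆]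
    congr 1
    refine sum_congr rfl fun A _ => ?_
    exact Finset.sum_eq_single (A.1, 1 - A.2) (fun B _ hB => by rw [normalCovariance_eq_zero_of_ne_bar sdot A B hB, zero_mul])
      (fun h => absurd (mem_univ _) h)
  have hc6n : ‖c₆‖ = 6 := by rw [hc₆]; exact norm_pairPositions_two'
  simp_rw [hker, torusFourierInv_const_mul, norm_mul, hc6n]
  have h := sum_mul_norm_torusFourierInv_sum_le_of_le (Finset.univ : Finset (HubbardFieldIdx L M))
    (fun A => normalCovariance L M sdot A (A.1, 1 - A.2))
    (fun A (kv : TorusSite 2 L) => kernel ℂ W 4 (Fin.snoc (Fin.snoc ![((((i, kv), σ), 0) : HubbardFieldIdx L M), (((i, kv), σ), 1)]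
      (A.1, 1 - A.2) : Fin 3 → HubbardFieldIdx L M) A)) hw0 (fun A _ => hN A)
  rw [sum_norm_normalCovariance_bar sdot] at h
  calc ∑ x, w x * (6 * ‖torusFourierInv (fun kv : TorusSite 2 L => ∑ A : HubbardFieldIdx L M, normalCovariance L M sdot A (A.1, 1 - A.2) *
          kernel ℂ W 4 (Fin.snoc (Fin.snoc ![((((i, kv), σ), 0) : HubbardFieldIdx L M), (((i, kv), σ), 1)] (A.1, 1 - A.2) :
            Fin 3 → HubbardFieldIdx L M) A)) x‖)
      = 6 * ∑ x, w x * ‖torusFourierInv (fun kv : TorusSite 2 L => ∑ A : HubbardFieldIdx L M, normalCovariance L M sdot A (A.1, 1 - A.2) *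
          kernel ℂ W 4 (Fin.snoc (Fin.snoc ![((((i, kv), σ), 0) : HubbardFieldIdx L M), (((i, kv), σ), 1)] (A.1, 1 - A.2) :
            Fin 3 → HubbardFieldIdx L M) A)) x‖ := by
        rw [mul_sum]; exact sum_congr rfl fun x _ => by ring
    _ ≤ 6 * ((2 * ∑ p, ‖sdot p‖) * N) := mul_le_mul_of_nonneg_left h (by norm_num)
    _ = 12 * (∑ p, ‖sdot p‖) * N := by ring

/-! ## §3 The response inequality in moment form -/

/-- **THE COVARIANCE RESPONSE OF THE TWO-LEG KERNEL IN MOMENT FORM** (Polchinski interpolation through the phase-weighted functional).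
`𝒲_t := effAction (C₀ + t(C₁ − C₀)) V_U`, `C_j = normalCovariance s_j`, reading strings `X_{(ω_i,k⃗,σ)}`, `w ≥ 0` submultiplicative
(`w(x+y) ≤ w(x)w(y)`).  If on `t ∈ [0,1]` the partition function does not vanish, the moments of the four-leg data `k⃗ ↦ 𝒲_{t,4}(X_{(ω_i,k⃗,σ)}, Ā, A)`
are `≤ N` (every `A`), those of the two-leg data `k⃗ ↦ 𝒲_{t,2}(X_{(ω_i,k⃗,σ)})` are `≤ S`, and those of the symbol difference `k⃗ ↦ (s₁−s₀)((ω_i,k⃗),σ)` are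
`≤ D`, then `Σ_x w(x)‖𝔉⁻¹[k⃗ ↦ 𝒲[s₁]₂(X) − 𝒲[s₀]₂(X)](x)‖ ≤ 12·(Σ_p‖(s₁−s₀) p‖)·N + 2·D·S²`. -/
theorem covResp_moment_kernel_two_sub_le (s₀ s₁ : FreqMomentum L M × Fin 2 → ℂ) (β U : ℝ) (i : MatsubaraIdx M) (σ : Fin 2)
    {w : TorusSite 2 L → ℝ} (hw0 : ∀ x, 0 ≤ w x) (hw : ∀ x y, w (x + y) ≤ w x * w y)
    (hZ : ∀ t ∈ Set.Icc (0 : ℝ) 1, effPartitionFn ℂ (normalCovariance L M s₀ + ((t : ℂ)) • (normalCovariance L M s₁ - normalCovariance L M s₀))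
      (hubbardInteraction L M β U) ≠ 0)
    {N S D : ℝ}
    (hN : ∀ t ∈ Set.Icc (0 : ℝ) 1, ∀ A : HubbardFieldIdx L M, ∑ x, w x * ‖torusFourierInv (fun kv : TorusSite 2 L =>
      kernel ℂ (effAction ℂ (normalCovariance L M s₀ + ((t : ℂ)) • (normalCovariance L M s₁ - normalCovariance L M s₀))
        (hubbardInteraction L M β U)) 4
        (Fin.snoc (Fin.snoc ![((((i, kv), σ), 0) : HubbardFieldIdx L M), (((i, kv), σ), 1)] (A.1, 1 - A.2) : Fin 3 → HubbardFieldIdx L M) A)) x‖ ≤ N)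
    (hS : ∀ t ∈ Set.Icc (0 : ℝ) 1, ∑ x, w x * ‖torusFourierInv (fun kv : TorusSite 2 L =>
      kernel ℂ (effAction ℂ (normalCovariance L M s₀ + ((t : ℂ)) • (normalCovariance L M s₁ - normalCovariance L M s₀))
        (hubbardInteraction L M β U)) 2 ![((((i, kv), σ), 0) : HubbardFieldIdx L M), (((i, kv), σ), 1)]) x‖ ≤ S)
    (hD : ∑ x, w x * ‖torusFourierInv (fun kv : TorusSite 2 L => s₁ ((i, kv), σ) - s₀ ((i, kv), σ)) x‖ ≤ D) :
    ∑ x, w x * ‖torusFourierInv (fun kv : TorusSite 2 L =>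
        kernel ℂ (effAction ℂ (normalCovariance L M s₁) (hubbardInteraction L M β U)) 2
            ![((((i, kv), σ), 0) : HubbardFieldIdx L M), (((i, kv), σ), 1)] -
          kernel ℂ (effAction ℂ (normalCovariance L M s₀) (hubbardInteraction L M β U)) 2
            ![((((i, kv), σ), 0) : HubbardFieldIdx L M), (((i, kv), σ), 1)]) x‖ ≤
      12 * (∑ p, ‖s₁ p - s₀ p‖) * N + 2 * D * S ^ 2 := by
  classical
  letI : LinearOrder (HubbardFieldIdx L M) := LinearOrder.lift' (Fintype.equivFin _) (Fintype.equivFin _).injective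
  -- reading strings and two-leg data
  set X : TorusSite 2 L → Fin 2 → HubbardFieldIdx L M := fun kv => ![((((i, kv), σ), 0) : HubbardFieldIdx L M), (((i, kv), σ), 1)] with hX
  set R : HubbardGrassmann L M → TorusSite 2 L → ℂ := fun F kv => kernel ℂ F 2 (X kv) with hR
  set W₁ := effAction ℂ (normalCovariance L M s₁) (hubbardInteraction L M β U) with hW₁
  set W₀ := effAction ℂ (normalCovariance L M s₀) (hubbardInteraction L M β U) with hW₀
  -- the endpoint difference and its phases
  set Rd : TorusSite 2 L → ℂ := fun x => torusFourierInv (fun kv => R W₁ kv - R W₀ kv) x with hRd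
  set u : TorusSite 2 L → ℂ := fun x => conj (Rd x) / (‖Rd x‖ : ℂ) with hu
  have hu1 : ∀ x, ‖u x‖ ≤ 1 := fun x => norm_conj_div_norm_le_one (Rd x)
  -- the phase-weighted functional
  let Φ : HubbardGrassmann L M →ₗ[ℂ] ℂ :=
    { toFun := fun F => ∑ x, (w x : ℂ) * u x * torusFourierInv (R F) x
      map_add' := fun F G => by
        rw [← sum_add_distrib]
        refine sum_congr rfl fun x _ => ?_
        rw [show R (F + G) = fun kv => R F kv + R G kv from funext fun kv => kernel_add ℂ F G 2 (X kv), torusFourierInv_add]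
        ring
      map_smul' := fun c F => by
        rw [RingHom.id_apply, smul_eq_mul, mul_sum]
        refine sum_congr rfl fun x _ => ?_
        rw [show R (c • F) = fun kv => c * R F kv from funext fun kv => kernel_smul ℂ c F 2 (X kv), torusFourierInv_const_mul]
        ring }
  have hΦapply : ∀ F, Φ F = ∑ x, (w x : ℂ) * u x * torusFourierInv (R F) x := fun F => rfl
  have hΦ1 : Φ 1 = 0 := by
    rw [hΦapply]
    refine sum_eq_zero fun x _ => ?_
    have h1 : R 1 = fun _ => 0 := funext fun kv => by
      show kernel ℂ (1 : HubbardGrassmann L M) 2 (X kv) = 0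
      rw [kernel_def, iterDeriv_succ_apply, grassmannDeriv_one, map_zero, map_zero, mul_zero]
    rw [h1, show torusFourierInv (fun _ : TorusSite 2 L => (0 : ℂ)) x = 0 by simp [torusFourierInv_eq_sum_torusChar], mul_zero]
  have hΦle : ∀ F, ‖Φ F‖ ≤ ∑ x, w x * ‖torusFourierInv (R F) x‖ := fun F => by
    rw [hΦapply]; exact norm_sum_weight_phase_mul_le hw0 hu1 _
  -- the endpoint value of `Φ` IS the weighted moment
  have hval : Φ W₁ - Φ W₀ = ((∑ x, w x * ‖Rd x‖ : ℝ) : ℂ) := by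
    rw [← map_sub, hΦapply]
    push_cast
    refine sum_congr rfl fun x _ => ?_
    rw [show R (W₁ - W₀) = fun kv => R W₁ kv - R W₀ kv from funext fun kv => by
        show kernel ℂ (W₁ - W₀) 2 (X kv) = _; rw [sub_eq_add_neg, kernel_add, ← neg_one_smul ℂ W₀, kernel_smul]; ring,
      mul_assoc, show torusFourierInv (fun kv => R W₁ kv - R W₀ kv) x = Rd x from rfl, conj_div_norm_mul_self]
  have hgoal : ∑ x, w x * ‖Rd x‖ = ‖Φ W₁ - Φ W₀‖ := by
    rw [hval, Complex.norm_real, Real.norm_of_nonneg (sum_nonneg fun x _ => mul_nonneg (hw0 x) (norm_nonneg _))]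
  show ∑ x, w x * ‖Rd x‖ ≤ _
  rw [hgoal]
  have hV0 := constPart_hubbardInteraction L M β U
  have hVe : hubbardInteraction L M β U ∈ evenOdd ℂ (ι := HubbardFieldIdx L M) 0 := hubbardInteraction_mem_evenOdd_zero β U
  refine norm_apply_effAction_sub_le_of_linePath (normalCovariance L M s₀) (normalCovariance L M s₁) hV0 hVe hZ Φ hΦ1 ?_
  intro t ht
  have hNt := hN t ht
  have hSt := hS t ht
  rw [normalCovariance_linePath, normalCovariance_sub]
  rw [normalCovariance_linePath] at hNt hSt
  set st : FreqMomentum L M × Fin 2 → ℂ := fun p => s₀ p + (t : ℂ) * (s₁ p - s₀ p) with hst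
  set W := effAction ℂ (normalCovariance L M st) (hubbardInteraction L M β U) with hW
  -- loop term
  have hloop : ‖Φ (grassmannLaplacian ℂ (normalCovariance L M fun p => s₁ p - s₀ p) W)‖ ≤ 12 * (∑ p, ‖s₁ p - s₀ p‖) * N :=
    (hΦle _).trans (covResp_moment_kernel_two_laplacian_le (fun p => s₁ p - s₀ p) W i σ hw0 hNt)
  -- tree term: pointwise a product
  have htree : R (grassmannDerivPairing ℂ (normalCovariance L M fun p => s₁ p - s₀ p) W W) =
      fun kv => 4 * ((s₁ ((i, kv), σ) - s₀ ((i, kv), σ)) * R W kv ^ 2) := funext fun kv => by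
    show kernel ℂ _ 2 (X kv) = _
    rw [hX]
    simp only
    rw [covResp_kernel_two_pairing_eq (fun p => s₁ p - s₀ p) st β U ((i, kv), σ)]
    ring
  have hS0 : 0 ≤ S := (sum_nonneg fun x _ => mul_nonneg (hw0 x) (norm_nonneg _)).trans hSt
  have hD0 : 0 ≤ D := (sum_nonneg fun x _ => mul_nonneg (hw0 x) (norm_nonneg _)).trans hD
  have htree_le : ‖(2 : ℂ)⁻¹ * Φ (grassmannDerivPairing ℂ (normalCovariance L M fun p => s₁ p - s₀ p) W W)‖ ≤ 2 * D * S ^ 2 := by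
    rw [norm_mul, norm_inv, RCLike.norm_ofNat]
    have h1 := hΦle (grassmannDerivPairing ℂ (normalCovariance L M fun p => s₁ p - s₀ p) W W)
    rw [htree] at h1
    simp_rw [torusFourierInv_const_mul, norm_mul, RCLike.norm_ofNat] at h1
    have h2 := sum_mul_norm_torusFourierInv_mul_sq_le hw0 hw (fun kv : TorusSite 2 L => s₁ ((i, kv), σ) - s₀ ((i, kv), σ)) (R W)
    have hSW : ∑ x, w x * ‖torusFourierInv (R W) x‖ ≤ S := hSt
    have h3 : ∑ x, w x * ‖torusFourierInv (fun kv : TorusSite 2 L => (s₁ ((i, kv), σ) - s₀ ((i, kv), σ)) * R W kv ^ 2) x‖ ≤ D * S ^ 2 :=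
      h2.trans (mul_le_mul hD (pow_le_pow_left₀ (sum_nonneg fun x _ => mul_nonneg (hw0 x) (norm_nonneg _)) hSW 2)
        (sq_nonneg _) hD0)
    calc 2⁻¹ * ‖Φ (grassmannDerivPairing ℂ (normalCovariance L M fun p => s₁ p - s₀ p) W W)‖
        ≤ 2⁻¹ * ∑ x, w x * (4 * ‖torusFourierInv (fun kv : TorusSite 2 L => (s₁ ((i, kv), σ) - s₀ ((i, kv), σ)) * R W kv ^ 2) x‖) :=
          mul_le_mul_of_nonneg_left h1 (by norm_num)
      _ = 2 * ∑ x, w x * ‖torusFourierInv (fun kv : TorusSite 2 L => (s₁ ((i, kv), σ) - s₀ ((i, kv), σ)) * R W kv ^ 2) x‖ := by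
          rw [mul_sum, mul_sum]; exact sum_congr rfl fun x _ => by ring
      _ ≤ 2 * (D * S ^ 2) := mul_le_mul_of_nonneg_left h3 (by norm_num)
      _ = 2 * D * S ^ 2 := by ring
  calc ‖Φ (grassmannLaplacian ℂ (normalCovariance L M fun p => s₁ p - s₀ p) W) -
        (2 : ℂ)⁻¹ * Φ (grassmannDerivPairing ℂ (normalCovariance L M fun p => s₁ p - s₀ p) W W)‖
      ≤ ‖Φ (grassmannLaplacian ℂ (normalCovariance L M fun p => s₁ p - s₀ p) W)‖ +
          ‖(2 : ℂ)⁻¹ * Φ (grassmannDerivPairing ℂ (normalCovariance L M fun p => s₁ p - s₀ p) W W)‖ := norm_sub_le _ _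
    _ ≤ 12 * (∑ p, ‖s₁ p - s₀ p‖) * N + 2 * D * S ^ 2 := add_le_add hloop htree_le

/-- **The same in the `selfEnergy` normalisation** (`selfEnergy = 2·βL²·kernel₂` at the string `(ψ̂⁺_{kσ}, ψ̂⁻_{kσ})`):
`Σ_x w(x)‖𝔉⁻¹[k⃗ ↦ Σ[s₁]((ω_i,k⃗),σ) − Σ[s₀]((ω_i,k⃗),σ)](x)‖ ≤ 2|β|L²·(12·(Σ_p‖(s₁−s₀) p‖)·N + 2·D·S²)`. -/
theorem selfEnergy_moment_sub_le (s₀ s₁ : FreqMomentum L M × Fin 2 → ℂ) (β U : ℝ) (i : MatsubaraIdx M) (σ : Fin 2)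
    {w : TorusSite 2 L → ℝ} (hw0 : ∀ x, 0 ≤ w x) (hw : ∀ x y, w (x + y) ≤ w x * w y)
    (hZ : ∀ t ∈ Set.Icc (0 : ℝ) 1, effPartitionFn ℂ (normalCovariance L M s₀ + ((t : ℂ)) • (normalCovariance L M s₁ - normalCovariance L M s₀))
      (hubbardInteraction L M β U) ≠ 0)
    {N S D : ℝ}
    (hN : ∀ t ∈ Set.Icc (0 : ℝ) 1, ∀ A : HubbardFieldIdx L M, ∑ x, w x * ‖torusFourierInv (fun kv : TorusSite 2 L =>
      kernel ℂ (effAction ℂ (normalCovariance L M s₀ + ((t : ℂ)) • (normalCovariance L M s₁ - normalCovariance L M s₀))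
        (hubbardInteraction L M β U)) 4
        (Fin.snoc (Fin.snoc ![((((i, kv), σ), 0) : HubbardFieldIdx L M), (((i, kv), σ), 1)] (A.1, 1 - A.2) : Fin 3 → HubbardFieldIdx L M) A)) x‖ ≤ N)
    (hS : ∀ t ∈ Set.Icc (0 : ℝ) 1, ∑ x, w x * ‖torusFourierInv (fun kv : TorusSite 2 L =>
      kernel ℂ (effAction ℂ (normalCovariance L M s₀ + ((t : ℂ)) • (normalCovariance L M s₁ - normalCovariance L M s₀))
        (hubbardInteraction L M β U)) 2 ![((((i, kv), σ), 0) : HubbardFieldIdx L M), (((i, kv), σ), 1)]) x‖ ≤ S)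
    (hD : ∑ x, w x * ‖torusFourierInv (fun kv : TorusSite 2 L => s₁ ((i, kv), σ) - s₀ ((i, kv), σ)) x‖ ≤ D) :
    ∑ x, w x * ‖torusFourierInv (fun kv : TorusSite 2 L =>
        selfEnergy L M β (effAction ℂ (normalCovariance L M s₁) (hubbardInteraction L M β U)) (i, kv) σ -
          selfEnergy L M β (effAction ℂ (normalCovariance L M s₀) (hubbardInteraction L M β U)) (i, kv) σ) x‖ ≤
      2 * (|β| * (L : ℝ) ^ 2) * (12 * (∑ p, ‖s₁ p - s₀ p‖) * N + 2 * D * S ^ 2) := by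
  have h := covResp_moment_kernel_two_sub_le s₀ s₁ β U i σ hw0 hw hZ hN hS hD
  set c : ℂ := ((((2 : ℕ).factorial : ℝ) * (β * (L : ℝ) ^ 2) ^ (2 - 1) : ℝ) : ℂ) with hc
  have hcn : ‖c‖ = 2 * (|β| * (L : ℝ) ^ 2) := by
    rw [hc, Complex.norm_real, Real.norm_eq_abs, Nat.factorial_two]
    simp [abs_mul, abs_pow]
  have hfun : (fun kv : TorusSite 2 L =>
        selfEnergy L M β (effAction ℂ (normalCovariance L M s₁) (hubbardInteraction L M β U)) (i, kv) σ -
          selfEnergy L M β (effAction ℂ (normalCovariance L M s₀) (hubbardInteraction L M β U)) (i, kv) σ) =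
      fun kv => c * (kernel ℂ (effAction ℂ (normalCovariance L M s₁) (hubbardInteraction L M β U)) 2
            ![((((i, kv), σ), 0) : HubbardFieldIdx L M), (((i, kv), σ), 1)] -
          kernel ℂ (effAction ℂ (normalCovariance L M s₀) (hubbardInteraction L M β U)) 2
            ![((((i, kv), σ), 0) : HubbardFieldIdx L M), (((i, kv), σ), 1)]) := by
    funext kv
    rw [selfEnergy, selfEnergy, vertexFn_def, vertexFn_def, ← hc, ← mul_sub]
  rw [hfun]
  simp_rw [torusFourierInv_const_mul, norm_mul, hcn]
  calc ∑ x, w x * (2 * (|β| * (L : ℝ) ^ 2) * ‖torusFourierInv (fun kv : TorusSite 2 L =>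
          kernel ℂ (effAction ℂ (normalCovariance L M s₁) (hubbardInteraction L M β U)) 2
              ![((((i, kv), σ), 0) : HubbardFieldIdx L M), (((i, kv), σ), 1)] -
            kernel ℂ (effAction ℂ (normalCovariance L M s₀) (hubbardInteraction L M β U)) 2
              ![((((i, kv), σ), 0) : HubbardFieldIdx L M), (((i, kv), σ), 1)]) x‖)
      = 2 * (|β| * (L : ℝ) ^ 2) * ∑ x, w x * ‖torusFourierInv (fun kv : TorusSite 2 L =>
          kernel ℂ (effAction ℂ (normalCovariance L M s₁) (hubbardInteraction L M β U)) 2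
              ![((((i, kv), σ), 0) : HubbardFieldIdx L M), (((i, kv), σ), 1)] -
            kernel ℂ (effAction ℂ (normalCovariance L M s₀) (hubbardInteraction L M β U)) 2
              ![((((i, kv), σ), 0) : HubbardFieldIdx L M), (((i, kv), σ), 1)]) x‖ := by
        rw [mul_sum]; exact sum_congr rfl fun x _ => by ring
    _ ≤ 2 * (|β| * (L : ℝ) ^ 2) * (12 * (∑ p, ‖s₁ p - s₀ p‖) * N + 2 * D * S ^ 2) := mul_le_mul_of_nonneg_left h (by positivity)

/-! ## §4 The frame-shift instance: loop part from door (1)'s `ℓ¹` symbol response, tree part conditional on the symbol moments -/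

/-- **The composed scale-`Λ` frame-shift MOMENT door for the two-leg kernel** (S6 door (2), the (B) half of stub (C) in jet currency): with
`s_j = uvSymbolCT … K_j Λ` the one-shot UV symbols of two frames, a non-negative submultiplicative weight `w`, the hypotheses of the moment door along the
interpolation (`Z_t ≠ 0`, four-leg moments `≤ N`, two-leg moments `≤ S`) and the symbol-difference moments at the reading frequency `≤ D`:
`Σ_x w(x)‖𝔉⁻¹[k⃗ ↦ Σ[𝒢(C^{K₁}_{>Λ},V_U)]((ω_i,k⃗),σ) − Σ[𝒢(C^{K₀}_{>Λ},V_U)]((ω_i,k⃗),σ)](x)‖ ≤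
2|β|L²·(12·(2L²(2B₁+1)βL²(2β/Λ)·frameDist K₁ K₀)·N + 2·D·S²)` — the loop part LINEAR in `frameDist K₁ K₀` at every scale (door (1)'s
`sum_norm_uvSymbolCT_sub_le`), the tree part linear in the symbol moments `D` (themselves linear in the frame-difference jets — the (S)-half supplier). -/
theorem moment_selfEnergy_frameShift_sub_le {B₁ : ℝ} (hB : ∀ y, |deriv salmhoferCutoff y| ≤ B₁) {β : ℝ} (hβ : 0 < β) {Λ : ℝ}
    (hΛ : 0 < Λ) (μ U : ℝ) (K₀ K₁ : TrigPolyC4v) {s₀ s₁ : FreqMomentum L M × Fin 2 → ℂ} (hs₀ : s₀ = uvSymbolCT L M β μ K₀ Λ)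
    (hs₁ : s₁ = uvSymbolCT L M β μ K₁ Λ) (i : MatsubaraIdx M) (σ : Fin 2)
    {w : TorusSite 2 L → ℝ} (hw0 : ∀ x, 0 ≤ w x) (hw : ∀ x y, w (x + y) ≤ w x * w y)
    (hZ : ∀ t ∈ Set.Icc (0 : ℝ) 1, effPartitionFn ℂ (normalCovariance L M s₀ + ((t : ℂ)) • (normalCovariance L M s₁ - normalCovariance L M s₀))
      (hubbardInteraction L M β U) ≠ 0)
    {N S D : ℝ}
    (hN : ∀ t ∈ Set.Icc (0 : ℝ) 1, ∀ A : HubbardFieldIdx L M, ∑ x, w x * ‖torusFourierInv (fun kv : TorusSite 2 L =>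
      kernel ℂ (effAction ℂ (normalCovariance L M s₀ + ((t : ℂ)) • (normalCovariance L M s₁ - normalCovariance L M s₀))
        (hubbardInteraction L M β U)) 4
        (Fin.snoc (Fin.snoc ![((((i, kv), σ), 0) : HubbardFieldIdx L M), (((i, kv), σ), 1)] (A.1, 1 - A.2) : Fin 3 → HubbardFieldIdx L M) A)) x‖ ≤ N)
    (hS : ∀ t ∈ Set.Icc (0 : ℝ) 1, ∑ x, w x * ‖torusFourierInv (fun kv : TorusSite 2 L =>
      kernel ℂ (effAction ℂ (normalCovariance L M s₀ + ((t : ℂ)) • (normalCovariance L M s₁ - normalCovariance L M s₀))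
        (hubbardInteraction L M β U)) 2 ![((((i, kv), σ), 0) : HubbardFieldIdx L M), (((i, kv), σ), 1)]) x‖ ≤ S)
    (hD : ∑ x, w x * ‖torusFourierInv (fun kv : TorusSite 2 L => s₁ ((i, kv), σ) - s₀ ((i, kv), σ)) x‖ ≤ D) :
    ∑ x, w x * ‖torusFourierInv (fun kv : TorusSite 2 L =>
        selfEnergy L M β (effAction ℂ (normalCovariance L M s₁) (hubbardInteraction L M β U)) (i, kv) σ -
          selfEnergy L M β (effAction ℂ (normalCovariance L M s₀) (hubbardInteraction L M β U)) (i, kv) σ) x‖ ≤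
      2 * (|β| * (L : ℝ) ^ 2) *
        (12 * (2 * (L : ℝ) ^ 2 * ((2 * B₁ + 1) * (β * (L : ℝ) ^ 2)) * (2 * β / Λ) * frameDist K₁ K₀) * N + 2 * D * S ^ 2) := by
  have h := selfEnergy_moment_sub_le s₀ s₁ β U i σ hw0 hw hZ hN hS hD
  refine h.trans ?_
  have hN0 : 0 ≤ N := by
    have h0 := hN 0 ⟨le_rfl, zero_le_one⟩ ((((i, (0 : TorusSite 2 L)), σ), 0) : HubbardFieldIdx L M)
    exact (sum_nonneg fun x _ => mul_nonneg (hw0 x) (norm_nonneg _)).trans h0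
  have h1 : ∑ p, ‖s₁ p - s₀ p‖ ≤ 2 * (L : ℝ) ^ 2 * ((2 * B₁ + 1) * (β * (L : ℝ) ^ 2)) * (2 * β / Λ) * frameDist K₁ K₀ := by
    subst hs₀ hs₁
    exact sum_norm_uvSymbolCT_sub_le hB hβ hΛ μ K₁ K₀
  have hβ' : 0 ≤ 2 * (|β| * (L : ℝ) ^ 2) := by positivity
  refine mul_le_mul_of_nonneg_left (add_le_add ?_ le_rfl) hβ'
  exact mul_le_mul_of_nonneg_right (mul_le_mul_of_nonneg_left h1 (by norm_num)) hN0

/-! ## §5 The bridge to the reading currency (`torusCosCoeff` moments of a real part) -/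

/-- **`torusCosCoeff` of the real part of complex momentum data is the real part of the symmetrised inverse transform**:
`(Re F)_c(x) = Re((F̌(x) + F̌(−x))/2)`. -/
theorem torusCosCoeff_re_eq (F : TorusSite 2 L → ℂ) (x : TorusSite 2 L) :
    torusCosCoeff L (fun k => (F k).re) x = ((torusFourierInv F x + torusFourierInv F (-x)) / 2).re := by
  rw [torusCosCoeff]
  exact cosCoeff_re_eq F x

/-- **Even-weighted `torusCosCoeff` moments of a real part are bounded by the moments of the inverse transform**: for `w ≥ 0` with `w(−x) = w(x)`,
`Σ_x w(x)|(Re F)_c(x)| ≤ Σ_x w(x)‖F̌(x)‖` — so the moment door above feeds `norm_iteratedFDeriv_evalM_symInterp_le_pure_moments` for the reading data. -/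
theorem sum_mul_abs_torusCosCoeff_re_le (F : TorusSite 2 L → ℂ) {w : TorusSite 2 L → ℝ} (hw0 : ∀ x, 0 ≤ w x) (hwe : ∀ x, w (-x) = w x) :
    ∑ x, w x * |torusCosCoeff L (fun k => (F k).re) x| ≤ ∑ x, w x * ‖torusFourierInv F x‖ := by
  have h := sum_mul_abs_cosCoeff_re_le F hw0 hwe
  simpa only [torusCosCoeff] using h

end Summit.HubbardSuperconductivity.HubbardSuperconductivity.Theorems.EngineV8

end
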